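import Summits.AtomisticToContinuum.Crystallization.Theorems.OverbindingBudgetMisfitWindow
import Summits.AtomisticToContinuum.Crystallization.Theorems.OverbindingBudgetMisfitPeriodicForm
import Summits.AtomisticToContinuum.Crystallization.Theorems.OverbindingBudgetShellHoleCover

/-!
# Shell-hole cover IV — the `GapFreeShells` slot discharged in the misfit-census cones

`OverbindingBudgetShellHoleCover.gapFreeShells_holds : GapFreeShells` is now a theorem, so every
cone of the `OverbindingBudget` misfit census that carried `GapFreeShells` as a hypothesis loses
that slot.  In particular the record cone XLIV
(`OverbindingBudgetMisfitWindow.rdef_of_ceg_shape_registered_gapFree`, six slots) becomes the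
five-slot cone `rdef_of_ceg_shape_registered`:
`ChargedEnergyGap → TwoShellShape (1/100) (3/50) (1/450) → RegisteredScaleGap (122/125) 0 4 (3/50) (1/450)
→ CleanlessExcessT → CoherentResidual 10 → RobustDefectLimitWindows`, and at geometric scale
`s = 0` the scale gaps alone give the misfit / gap energy gaps.
-/

namespace Summit.AtomisticToContinuum.Crystallization.Theorems.OverbindingBudgetShellHoleCone

open Summit.AtomisticToContinuum.Crystallization.Theses.OverbindingBudget (RobustDefectLimitWindows)
open Summit.AtomisticToContinuum.Crystallization.Theses.PricedLinkCensus (ChargedEnergyGap)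
open Summit.AtomisticToContinuum.Crystallization.Theorems.OverbindingBudgetGradedBareness (CleanlessExcessT)
open Summit.AtomisticToContinuum.Crystallization.Theorems.OverbindingBudgetCoherentCut (CoherentResidual)
open Summit.AtomisticToContinuum.Crystallization.Theorems.OverbindingBudgetGrossMargin (GrossLiouvilleLaw)
open Summit.AtomisticToContinuum.Crystallization.Theorems.OverbindingBudgetTwoShellShape (TwoShellShape)
open Summit.AtomisticToContinuum.Crystallization.Theorems.OverbindingBudgetMisfitCensusStatements
  (ScaleEnergyGap MisfitEnergyGap GapEnergyGap GapFreeShells misfitEnergyGap_zero_of_scale_gapFree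
    gapEnergyGap_of_misfitEnergyGap)
open Summit.AtomisticToContinuum.Crystallization.Theorems.OverbindingBudgetMisfitCensus
  (grossLiouvilleLaw_record_of_scale_gapFree rdef_of_ceg_scale_gapFree)
open Summit.AtomisticToContinuum.Crystallization.Theorems.OverbindingBudgetMisfitRegistration
  (RegisteredScaleGap NearChargeGap rdef_of_ceg_shape_registered_nearCharge_gapFree)
open Summit.AtomisticToContinuum.Crystallization.Theorems.OverbindingBudgetMisfitPeriodicForm
  (PeriodicScalePricing rdef_of_ceg_periodicScale_gapFree)
open Summit.AtomisticToContinuum.Crystallization.Theorems.OverbindingBudgetMisfitWindowStatements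
  (ScaleEnergyGapW MisfitEnergyGapW TameScaleGap TameMisfitGap misfitEnergyGapW_zero_of_scale_gapFree
    tameMisfitGap_zero_of_tameScale_gapFree)
open Summit.AtomisticToContinuum.Crystallization.Theorems.OverbindingBudgetMisfitWindow
  (rdef_of_ceg_tameScale_gapFree rdef_of_ceg_shape_registered_gapFree)
open Summit.AtomisticToContinuum.Crystallization.Theorems.OverbindingBudgetShellHoleCover (gapFreeShells_holds)

/-! ## Scale gaps give misfit and gap energy gaps at `s = 0` -/

/-- `ScaleEnergyGap a 0 → MisfitEnergyGap a 0` (the gap-free-shell hypothesis discharged). [this file] -/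
theorem misfitEnergyGap_zero_of_scale {a : ℝ} (hS : ScaleEnergyGap a 0) : MisfitEnergyGap a 0 :=
  misfitEnergyGap_zero_of_scale_gapFree hS gapFreeShells_holds

/-- `ScaleEnergyGap a 0 → GapEnergyGap a 0`. [this file] -/
theorem gapEnergyGap_zero_of_scale {a : ℝ} (hS : ScaleEnergyGap a 0) : GapEnergyGap a 0 :=
  gapEnergyGap_of_misfitEnergyGap (misfitEnergyGap_zero_of_scale hS)

/-- Windowed form: `ScaleEnergyGapW a 0 σ₁ σ₂ → MisfitEnergyGapW a 0 σ₁ σ₂`. [this file] -/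
theorem misfitEnergyGapW_zero_of_scale {a σ₁ σ₂ : ℝ} (hS : ScaleEnergyGapW a 0 σ₁ σ₂) :
    MisfitEnergyGapW a 0 σ₁ σ₂ :=
  misfitEnergyGapW_zero_of_scale_gapFree hS gapFreeShells_holds

/-- Tame form: `TameScaleGap a 0 → TameMisfitGap a 0`. [this file] -/
theorem tameMisfitGap_zero_of_tameScale {a : ℝ} (hS : TameScaleGap a 0) : TameMisfitGap a 0 :=
  tameMisfitGap_zero_of_tameScale_gapFree hS gapFreeShells_holds

/-- The record residual from the scale energy gap alone. [this file] -/
theorem grossLiouvilleLaw_record_of_scale (hS : ScaleEnergyGap (122 / 125) 0) : GrossLiouvilleLaw (1 / 250) 10 :=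
  grossLiouvilleLaw_record_of_scale_gapFree hS gapFreeShells_holds

/-! ## The cones without the `GapFreeShells` slot -/

/-- Cone XLI minus `GapFreeShells`: `ChargedEnergyGap → ScaleEnergyGap (122/125) 0 → CleanlessExcessT → CoherentResidual 10 →
RobustDefectLimitWindows`. [this file] -/
theorem rdef_of_ceg_scale (hCEG : ChargedEnergyGap) (hS : ScaleEnergyGap (122 / 125) 0) (hCE : CleanlessExcessT)
    (hRes : CoherentResidual 10) : RobustDefectLimitWindows :=
  rdef_of_ceg_scale_gapFree hCEG hS gapFreeShells_holds hCE hRes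

/-- Cone XLI-W minus `GapFreeShells`: `ChargedEnergyGap → TameScaleGap (122/125) 0 → CleanlessExcessT → CoherentResidual 10 →
RobustDefectLimitWindows`. [this file] -/
theorem rdef_of_ceg_tameScale (hCEG : ChargedEnergyGap) (hS : TameScaleGap (122 / 125) 0) (hCE : CleanlessExcessT)
    (hRes : CoherentResidual 10) : RobustDefectLimitWindows :=
  rdef_of_ceg_tameScale_gapFree hCEG hS gapFreeShells_holds hCE hRes

/-- **CONE XLV — the record instance, FIVE slots** (cone XLIV minus `GapFreeShells`, nothing in its place):
`ChargedEnergyGap → TwoShellShape (1/100) (3/50) (1/450) → RegisteredScaleGap (122/125) 0 4 (3/50) (1/450) → CleanlessExcessT →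
CoherentResidual 10 → RobustDefectLimitWindows`. [this file] -/
theorem rdef_of_ceg_shape_registered (hCEG : ChargedEnergyGap) (hT : TwoShellShape (1 / 100) (3 / 50) (1 / 450))
    (hR : RegisteredScaleGap (122 / 125) 0 4 (3 / 50) (1 / 450)) (hCE : CleanlessExcessT) (hRes : CoherentResidual 10) :
    RobustDefectLimitWindows :=
  rdef_of_ceg_shape_registered_gapFree hCEG hT hR gapFreeShells_holds hCE hRes

/-- Cone XLIII minus `GapFreeShells` (with the rim slot `NearChargeGap (33/2)` kept). [this file] -/
theorem rdef_of_ceg_shape_registered_nearCharge (hCEG : ChargedEnergyGap) (hT : TwoShellShape (1 / 100) (3 / 50) (1 / 450))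
    (hR : RegisteredScaleGap (122 / 125) 0 4 (3 / 50) (1 / 450)) (hNC : NearChargeGap (33 / 2)) (hCE : CleanlessExcessT)
    (hRes : CoherentResidual 10) : RobustDefectLimitWindows :=
  rdef_of_ceg_shape_registered_nearCharge_gapFree hCEG hT hR hNC gapFreeShells_holds hCE hRes

/-- The periodic-normal-form cone minus `GapFreeShells`: `ChargedEnergyGap → PeriodicScalePricing (122/125) 0 c C → CleanlessExcessT →
CoherentResidual 10 → RobustDefectLimitWindows` (`c > 0`). [this file] -/
theorem rdef_of_ceg_periodicScale {c C : ℝ} (hc : 0 < c) (hCEG : ChargedEnergyGap) (hP : PeriodicScalePricing (122 / 125) 0 c C)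
    (hCE : CleanlessExcessT) (hRes : CoherentResidual 10) : RobustDefectLimitWindows :=
  rdef_of_ceg_periodicScale_gapFree hc hCEG hP gapFreeShells_holds hCE hRes

end Summit.AtomisticToContinuum.Crystallization.Theorems.OverbindingBudgetShellHoleCone
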